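import Literature.Geometry.Lorentzian.DevelopmentGluingMetric
import Literature.Geometry.Lorentzian.TimelikeCurveLift
import Literature.Geometry.Lorentzian.CausalityClosedProofs
import HarnessLib

/-!
# Gluing two globally hyperbolic developments along a common development: the glued data
# hypersurface is a Cauchy hypersurface (Sbierski 2016, §3.3, proof of Thm. 5)

Third file of the gluing construction (`DevelopmentGluingData`: the glued space `M̃`;
`DevelopmentGluingMetric`: its Lorentzian metric `g̃` and time orientation `T̃`). Here the bullet

> *"`(M̃, g̃)` is globally hyperbolic with Cauchy surface `ι̃(M̄)`: … So let `γ : I → M̃` be an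
> inextendible timelike curve. Take `t₀ ∈ I` and assume `γ(t₀) ∈ (π ∘ j)(M)`. If we denote with
> `J ∋ t₀` the maximal connected subinterval of `I` such that `γ(J) ⊆ (π ∘ j)(M)`, then `γ|_J`
> can be considered as an inextendible timelike curve in `M` and thus has to intersect `ι(M̄)`.
> Hence `γ` intersects `ι̃(M̄)` at least once. Let us now assume that `γ` intersected `ι̃(M̄)`
> more than once … Since `M` and `M'` are globally hyperbolic, `γ|_{[t₁,t₃]}` cannot be contained
> entirely in `π ∘ j(M)` or `π ∘ j'(M')`. Thus, there must be `t₂, t₁₂, t₂₃` with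
> `t₁ < t₁₂ < t₂ < t₂₃ < t₃` such that `γ(t₂) ∈ (π ∘ j)(U)` and … `γ(t₁₂) ∉ (π ∘ j')(M')` and
> `γ(t₂₃) ∉ (π ∘ j)(M)`. But this leads to an inextendible timelike curve in `U` that does not
> intersect `ι(M̄)`, a contradiction, since `U` is globally hyperbolic."*

of J. Sbierski, Ann. Henri Poincaré 17 (2016) = arXiv:1309.7591v3, §3.3, proof of Thm. 5, over
the tree's corrected Cauchy-hypersurface notion (`LorentzianMetric.IsCauchyHypersurface`: met
exactly once by every endless timelike curve):

* `LorentzianMetric.exists_lift_isEndlessTimelikeCurve` — **lifting endless timelike curves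
  along an injective local isometry**: for `Φ : N → P` an injective local diffeomorphism which is
  a time-orientation preserving isometric immersion of time-oriented Lorentzian manifolds, the
  piece of an endless timelike curve `γ` of `P` through a point of `Φ(N)` (the connected
  component `J` of `γ⁻¹(Φ(N))`) lifts to an endless timelike curve of `N` on `J` — the printed
  "`γ|_J` can be considered as an inextendible timelike curve in `M`" (the pieces `π ∘ j`,
  `π ∘ j'` and the overlap `(π ∘ j)(U)` of the glued development are such `Φ`);
* `CommonDevelopment.isClosed_range_gluedEmbed` — `ι̃(X)` is closed in `M̃` (Cauchy
  hypersurfaces are closed, `IsCauchyHypersurface.isClosed_holds`);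
* `CommonDevelopment.isCauchyHypersurface_glued` — **`ι̃(X) = π j (ι(X))` is a Cauchy hypersurface
  of `(M̃, g̃, T̃)`**. Existence of a crossing as printed. For uniqueness the printed argument
  tacitly takes two *consecutive* crossings `t₁ < t₃`; we supply this: within one piece there is
  at most one crossing (lift to `M` or `M'`), so the crossings in `[t₁, t₃]` form a closed set
  without accumulation at `t₁`, whose least element above `t₁` is a crossing `t₃'` with none in
  `(t₁, t₃')`; then the printed argument produces a crossing strictly in between (the overlap
  piece through a parameter between a point outside `π j'(M')` and a point outside `π j(M)`
  lifts to an endless timelike curve of `U`, which meets `ι(X)`) — contradiction.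

Everything is proved; no definitions and no named facts are introduced (D-0026).

## References

* J. Sbierski, Ann. Henri Poincaré 17 (2016) 301–329 = arXiv:1309.7591v3, §3.3, proof of
  Thm. 5 (global hyperbolicity step, p. 18 of the arXiv version).
* B. O'Neill, *Semi-Riemannian geometry with applications to relativity*, 1983, Ch. 14,
  Def. 14.28, Lemma 14.29.
* Y. Choquet-Bruhat, R. Geroch, Comm. Math. Phys. 14 (1969) 329–335, proof of Thm. 3, p. 334.
-/

noncomputable section

open Bundle Set Function Filter TopologicalSpace Topology Manifold
open scoped Manifold ContDiff Topology
open Literature.Topology.FourManifolds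

namespace Literature.Geometry.Lorentzian

universe u


/-! ### The three injective local isometries into the glued spacetime -/

section Developments

variable {n : ℕ} {X : Type u} [TopologicalSpace X] [ChartedSpace (EuclideanSpace ℝ (Fin n)) X]
  [IsManifold (𝓡 n) ∞ X] [ConnectedSpace X] {D : InitialDataSet (𝓡 n) X}

namespace CauchyDevelopment

namespace CommonDevelopment

variable {𝒟 𝒟' : CauchyDevelopment D} (𝔠 : CommonDevelopment 𝒟 𝒟')

/-- `π j : M → M̃` is a local diffeomorphism (an isometric immersion between equidimensional
Lorentzian manifolds). [folklore] -/
theorem isLocalDiffeomorph_inl : IsLocalDiffeomorph (𝓡 (n + 1)) (𝓡 (n + 1)) ∞ 𝔠.inl :=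
  LorentzianMetric.isLocalDiffeomorph_of_isIsometricImmersion 𝔠.isIsometricImmersion_inl

/-- `π j' : M' → M̃` is a local diffeomorphism. [folklore] -/
theorem isLocalDiffeomorph_inr : IsLocalDiffeomorph (𝓡 (n + 1)) (𝓡 (n + 1)) ∞ 𝔠.inr :=
  LorentzianMetric.isLocalDiffeomorph_of_isIsometricImmersion 𝔠.isIsometricImmersion_inr

/-- **The overlap `π j(U) = π j(M) ∩ π j'(M')`** is the range of `π j` restricted to `U`.
[cite: Sbierski2016AHP, §3.3, proof of Thm. 5] -/
theorem range_inl_comp_subtypeVal :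
    range (𝔠.inl ∘ (Subtype.val : 𝔠.opens → 𝒟.carrier)) = range 𝔠.inl ∩ range 𝔠.inr := by
  ext p
  constructor
  · rintro ⟨y, rfl⟩
    refine ⟨⟨y.1, rfl⟩, ?_⟩
    exact 𝔠.glueData.inl_mem_range_inr_iff.2 (by rw [glueData_glue, glue_source]; exact y.2)
  · rintro ⟨⟨a, rfl⟩, ha⟩
    have ha' : a ∈ 𝔠.opens := by
      have h := 𝔠.glueData.inl_mem_range_inr_iff.1 ha
      rw [glueData_glue, glue_source] at h
      exact h
    exact ⟨⟨a, ha'⟩, rfl⟩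

/-- **The overlap map `π j|_U : U → M̃` is an isometric immersion** of the open sub-spacetime
`(U, g|_U)`. [cite: Sbierski2016AHP, §3.3, proof of Thm. 5] -/
theorem isIsometricImmersion_inl_comp_subtypeVal :
    (𝒟.metric.restrict PseudoRiemannianMetric.contMDiff_restrict_holds 𝔠.opens).IsIsometricImmersion
      𝔠.gluedMetric.toPseudoRiemannianMetric (𝔠.inl ∘ (Subtype.val : 𝔠.opens → 𝒟.carrier)) := by
  have hd : MDifferentiable (𝓡 (n + 1)) (𝓡 (n + 1)) 𝔠.inl :=
    𝔠.glueData.contMDiff_inl.mdifferentiable (by simp)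
  refine ⟨𝔠.glueData.contMDiff_inl.comp contMDiff_subtype_val, fun y ↦ ?_⟩
  ext v w
  rw [pullbackBilin_apply, mfderiv_comp_subtypeVal (hd _)]
  exact 𝔠.val_gluedMetric_inl y.1 v w

/-- The overlap map preserves the time orientations. [cite: Sbierski2016AHP, §3.3, proof of Thm. 5] -/
theorem preservesTimeOrientation_inl_comp_subtypeVal (h : ¬ 𝔠.HasCorrespondingBoundaryPoints) :
    (𝒟.timeOrientation.restrict PseudoRiemannianMetric.contMDiff_restrict_holds
      𝒟.timeOrientation.contMDiff_restrict_holds 𝔠.opens).PreservesTimeOrientation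
      (𝔠.inl ∘ (Subtype.val : 𝔠.opens → 𝒟.carrier)) (𝔠.gluedTimeOrientation h) := by
  have hd : MDifferentiable (𝓡 (n + 1)) (𝓡 (n + 1)) 𝔠.inl :=
    𝔠.glueData.contMDiff_inl.mdifferentiable (by simp)
  intro y
  rw [mfderiv_comp_subtypeVal (hd _)]
  exact 𝔠.preservesTimeOrientation_inl h y.1

/-- The overlap map is an injective local diffeomorphism. [folklore] -/
theorem isLocalDiffeomorph_inl_comp_subtypeVal :
    IsLocalDiffeomorph (𝓡 (n + 1)) (𝓡 (n + 1)) ∞ (𝔠.inl ∘ (Subtype.val : 𝔠.opens → 𝒟.carrier)) ∧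
      Injective (𝔠.inl ∘ (Subtype.val : 𝔠.opens → 𝒟.carrier)) :=
  ⟨LorentzianMetric.isLocalDiffeomorph_of_isIsometricImmersion 𝔠.isIsometricImmersion_inl_comp_subtypeVal,
    𝔠.glueData.inl_injective.comp Subtype.val_injective⟩

/-! ### The glued data hypersurface `ι̃(X) = π j(ι(X))` -/

/-- A point of `ι̃(X)` lies in the overlap `π j(M) ∩ π j'(M')`. [cite: Sbierski2016AHP, §3.3, proof of Thm. 5] -/
theorem range_gluedEmbed_subset :
    range (𝔠.inl ∘ 𝒟.embed) ⊆ range 𝔠.inl ∩ range 𝔠.inr := by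
  rintro _ ⟨x, rfl⟩
  exact ⟨⟨𝒟.embed x, rfl⟩, ⟨𝒟'.embed x, (𝔠.inl_embed_eq_inr_embed x).symm⟩⟩

/-- **`ι̃(X)` is closed in `M̃`**: its complement is `π j(M ∖ ι(X)) ∪ π j'(M' ∖ ι'(X))`, open
since Cauchy hypersurfaces are closed (`IsCauchyHypersurface.isClosed_holds`) and `π j`, `π j'`
are open maps. [cite: Sbierski2016AHP, §3.3, proof of Thm. 5] -/
theorem isClosed_range_gluedEmbed : IsClosed (range (𝔠.inl ∘ 𝒟.embed)) := by
  have hn2 : (2 : ℕ∞ω) ≤ ∞ := WithTop.coe_le_coe.mpr le_top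
  have h1 : IsClosed (range 𝒟.embed) :=
    LorentzianMetric.IsCauchyHypersurface.isClosed_holds hn2 𝒟.isCauchyHypersurface
  have h2 : IsClosed (range 𝒟'.embed) :=
    LorentzianMetric.IsCauchyHypersurface.isClosed_holds hn2 𝒟'.isCauchyHypersurface
  rw [← isOpen_compl_iff]
  have heq : (range (𝔠.inl ∘ 𝒟.embed))ᶜ =
      𝔠.inl '' (range 𝒟.embed)ᶜ ∪ 𝔠.inr '' (range 𝒟'.embed)ᶜ := by
    ext p
    constructor
    · intro hp
      obtain (⟨a, rfl⟩ | ⟨b, rfl⟩) := 𝔠.glueData.exists_inl_or_inr p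
      · refine Or.inl ⟨a, fun ⟨x, hx⟩ ↦ hp ⟨x, ?_⟩, rfl⟩
        simp only [comp_apply, hx]
      · refine Or.inr ⟨b, fun ⟨x, hx⟩ ↦ hp ⟨x, ?_⟩, rfl⟩
        simp only [comp_apply]
        rw [𝔠.inl_embed_eq_inr_embed x, hx]
    · rintro (⟨a, ha, rfl⟩ | ⟨b, hb, rfl⟩) ⟨x, hx⟩
      · exact ha ⟨x, 𝔠.glueData.inl_injective hx⟩
      · apply hb
        refine ⟨x, 𝔠.glueData.inr_injective ?_⟩
        change 𝔠.inr (𝒟'.embed x) = 𝔠.inr b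
        rw [← 𝔠.inl_embed_eq_inr_embed x]
        exact hx
  rw [heq]
  exact (𝔠.glueData.isOpenMap_inl _ h1.isOpen_compl).union
    (𝔠.glueData.isOpenMap_inr _ h2.isOpen_compl)

/-! ### Crossings of `ι̃(X)` by endless timelike curves of the glued spacetime -/

variable {𝔠}

/-- **A piece of an endless timelike curve of `M̃` inside `π j(M)` meets `ι̃(X)`, at most once**
(lift to `M`, where `ι(X)` is a Cauchy hypersurface: exactly one crossing on the piece).
[cite: Sbierski2016AHP, §3.3, proof of Thm. 5 (global hyperbolicity step)] -/
theorem crossing_inl (h : ¬ 𝔠.HasCorrespondingBoundaryPoints) {γ : ℝ → 𝔠.Glued} {s : Set ℝ}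
    (hγ : 𝔠.gluedMetric.IsEndlessTimelikeCurve (𝔠.gluedTimeOrientation h) γ s) {t₀ : ℝ}
    (ht₀ : t₀ ∈ s) (hγt₀ : γ t₀ ∈ range 𝔠.inl) :
    (∃ t ∈ connectedComponentIn (s ∩ γ ⁻¹' range 𝔠.inl) t₀, γ t ∈ range (𝔠.inl ∘ 𝒟.embed)) ∧
      ∀ t₁ ∈ connectedComponentIn (s ∩ γ ⁻¹' range 𝔠.inl) t₀,
        ∀ t₂ ∈ connectedComponentIn (s ∩ γ ⁻¹' range 𝔠.inl) t₀,
          γ t₁ ∈ range (𝔠.inl ∘ 𝒟.embed) → γ t₂ ∈ range (𝔠.inl ∘ 𝒟.embed) → t₁ = t₂ := by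
  haveI := 𝔠.t2Space_glued h
  obtain ⟨δ, hδ, hδc⟩ := LorentzianMetric.exists_lift_isEndlessTimelikeCurve 𝒟.timeOrientation
    (𝔠.gluedTimeOrientation h) 𝔠.isIsometricImmersion_inl (𝔠.preservesTimeOrientation_inl h)
    𝔠.glueData.inl_injective 𝔠.isLocalDiffeomorph_inl hγ ht₀ hγt₀
  -- a crossing of the lift is a crossing of `γ`, and conversely
  have hmem : ∀ t ∈ connectedComponentIn (s ∩ γ ⁻¹' range 𝔠.inl) t₀,
      (γ t ∈ range (𝔠.inl ∘ 𝒟.embed) ↔ δ t ∈ range 𝒟.embed) := fun t ht ↦ by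
    constructor
    · rintro ⟨x, hx⟩
      refine ⟨x, 𝔠.glueData.inl_injective ?_⟩
      change 𝔠.inl (𝒟.embed x) = 𝔠.inl (δ t)
      rw [hδ t ht]
      exact hx
    · rintro ⟨x, hx⟩
      exact ⟨x, by change 𝔠.inl (𝒟.embed x) = γ t; rw [hx, hδ t ht]⟩
  refine ⟨?_, fun t₁ ht₁ t₂ ht₂ h₁ h₂ ↦ ?_⟩
  · obtain ⟨t, ⟨ht, hx⟩, -⟩ := 𝒟.isCauchyHypersurface δ _ hδc
    exact ⟨t, ht, (hmem t ht).2 hx⟩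
  · exact LorentzianMetric.IsCauchyHypersurface.eq_of_mem_of_mem (WithTop.coe_le_coe.mpr le_top)
      𝒟.isCauchyHypersurface hδc.1 hδc.2.1 ht₁ ht₂ ((hmem t₁ ht₁).1 h₁) ((hmem t₂ ht₂).1 h₂)

/-- **A piece of an endless timelike curve of `M̃` inside `π j'(M')` meets `ι̃(X)`, at most once**
(lift to `M'`; `ι̃(X) = π j'(ι'(X))`). [cite: Sbierski2016AHP, §3.3, proof of Thm. 5 (global hyperbolicity step)] -/
theorem crossing_inr (h : ¬ 𝔠.HasCorrespondingBoundaryPoints) {γ : ℝ → 𝔠.Glued} {s : Set ℝ}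
    (hγ : 𝔠.gluedMetric.IsEndlessTimelikeCurve (𝔠.gluedTimeOrientation h) γ s) {t₀ : ℝ}
    (ht₀ : t₀ ∈ s) (hγt₀ : γ t₀ ∈ range 𝔠.inr) :
    (∃ t ∈ connectedComponentIn (s ∩ γ ⁻¹' range 𝔠.inr) t₀, γ t ∈ range (𝔠.inl ∘ 𝒟.embed)) ∧
      ∀ t₁ ∈ connectedComponentIn (s ∩ γ ⁻¹' range 𝔠.inr) t₀,
        ∀ t₂ ∈ connectedComponentIn (s ∩ γ ⁻¹' range 𝔠.inr) t₀,
          γ t₁ ∈ range (𝔠.inl ∘ 𝒟.embed) → γ t₂ ∈ range (𝔠.inl ∘ 𝒟.embed) → t₁ = t₂ := by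
  haveI := 𝔠.t2Space_glued h
  obtain ⟨δ, hδ, hδc⟩ := LorentzianMetric.exists_lift_isEndlessTimelikeCurve 𝒟'.timeOrientation
    (𝔠.gluedTimeOrientation h) 𝔠.isIsometricImmersion_inr (𝔠.preservesTimeOrientation_inr h)
    𝔠.glueData.inr_injective 𝔠.isLocalDiffeomorph_inr hγ ht₀ hγt₀
  have hmem : ∀ t ∈ connectedComponentIn (s ∩ γ ⁻¹' range 𝔠.inr) t₀,
      (γ t ∈ range (𝔠.inl ∘ 𝒟.embed) ↔ δ t ∈ range 𝒟'.embed) := fun t ht ↦ by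
    constructor
    · rintro ⟨x, hx⟩
      refine ⟨x, 𝔠.glueData.inr_injective ?_⟩
      change 𝔠.inr (𝒟'.embed x) = 𝔠.inr (δ t)
      rw [hδ t ht, ← 𝔠.inl_embed_eq_inr_embed x]
      exact hx
    · rintro ⟨x, hx⟩
      exact ⟨x, by
        change 𝔠.inl (𝒟.embed x) = γ t
        rw [𝔠.inl_embed_eq_inr_embed x, hx, hδ t ht]⟩
  refine ⟨?_, fun t₁ ht₁ t₂ ht₂ h₁ h₂ ↦ ?_⟩
  · obtain ⟨t, ⟨ht, hx⟩, -⟩ := 𝒟'.isCauchyHypersurface δ _ hδc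
    exact ⟨t, ht, (hmem t ht).2 hx⟩
  · exact LorentzianMetric.IsCauchyHypersurface.eq_of_mem_of_mem (WithTop.coe_le_coe.mpr le_top)
      𝒟'.isCauchyHypersurface hδc.1 hδc.2.1 ht₁ ht₂ ((hmem t₁ ht₁).1 h₁) ((hmem t₂ ht₂).1 h₂)

/-- **A piece of an endless timelike curve of `M̃` inside the overlap `π j(U)` meets `ι̃(X)`**
(lift to the open sub-spacetime `U`, in which `ι(X)` is a Cauchy hypersurface: *"this leads to
an inextendible timelike curve in `U`"*). [cite: Sbierski2016AHP, §3.3, proof of Thm. 5 (global hyperbolicity step)] -/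
theorem crossing_overlap (h : ¬ 𝔠.HasCorrespondingBoundaryPoints) {γ : ℝ → 𝔠.Glued} {s : Set ℝ}
    (hγ : 𝔠.gluedMetric.IsEndlessTimelikeCurve (𝔠.gluedTimeOrientation h) γ s) {t₀ : ℝ}
    (ht₀ : t₀ ∈ s) (hγt₀ : γ t₀ ∈ range (𝔠.inl ∘ (Subtype.val : 𝔠.opens → 𝒟.carrier))) :
    ∃ t ∈ connectedComponentIn (s ∩ γ ⁻¹' range (𝔠.inl ∘ (Subtype.val : 𝔠.opens → 𝒟.carrier))) t₀,
      γ t ∈ range (𝔠.inl ∘ 𝒟.embed) := by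
  haveI := 𝔠.t2Space_glued h
  obtain ⟨δ, hδ, hδc⟩ := LorentzianMetric.exists_lift_isEndlessTimelikeCurve
    (𝒟.timeOrientation.restrict PseudoRiemannianMetric.contMDiff_restrict_holds
      𝒟.timeOrientation.contMDiff_restrict_holds 𝔠.opens)
    (𝔠.gluedTimeOrientation h) 𝔠.isIsometricImmersion_inl_comp_subtypeVal
    (𝔠.preservesTimeOrientation_inl_comp_subtypeVal h) 𝔠.isLocalDiffeomorph_inl_comp_subtypeVal.2
    𝔠.isLocalDiffeomorph_inl_comp_subtypeVal.1 hγ ht₀ hγt₀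
  obtain ⟨t, ⟨ht, x, hx⟩, -⟩ := 𝔠.isCauchyHypersurface δ _ hδc
  refine ⟨t, ht, x, ?_⟩
  change 𝔠.inl (𝒟.embed x) = γ t
  rw [← hδ t ht, comp_apply, ← hx]

/-- Every parameter has a parameter neighbourhood containing at most one crossing of `ι̃(X)`
(the curve stays in the open piece `π j(M)` or `π j'(M')` near the parameter, where crossings are
unique, `crossing_inl`/`crossing_inr`). [cite: Sbierski2016AHP, §3.3, proof of Thm. 5 (global hyperbolicity step)] -/
theorem crossing_locally_unique (h : ¬ 𝔠.HasCorrespondingBoundaryPoints) {γ : ℝ → 𝔠.Glued}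
    {s : Set ℝ} (hγ : 𝔠.gluedMetric.IsEndlessTimelikeCurve (𝔠.gluedTimeOrientation h) γ s)
    {t : ℝ} (ht : t ∈ s) :
    ∃ ε > 0, ∀ t₁ ∈ s, ∀ t₂ ∈ s, |t₁ - t| < ε → |t₂ - t| < ε →
      γ t₁ ∈ range (𝔠.inl ∘ 𝒟.embed) → γ t₂ ∈ range (𝔠.inl ∘ 𝒟.embed) → t₁ = t₂ := by
  have hcont : ContinuousAt γ t := (hγ.2.1 t ht).1.continuousAt
  -- the open piece through `γ t`
  have key : ∀ (O : Set 𝔠.Glued), IsOpen O → γ t ∈ O →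
      (∀ t₁ ∈ connectedComponentIn (s ∩ γ ⁻¹' O) t, ∀ t₂ ∈ connectedComponentIn (s ∩ γ ⁻¹' O) t,
        γ t₁ ∈ range (𝔠.inl ∘ 𝒟.embed) → γ t₂ ∈ range (𝔠.inl ∘ 𝒟.embed) → t₁ = t₂) →
      ∃ ε > 0, ∀ t₁ ∈ s, ∀ t₂ ∈ s, |t₁ - t| < ε → |t₂ - t| < ε →
        γ t₁ ∈ range (𝔠.inl ∘ 𝒟.embed) → γ t₂ ∈ range (𝔠.inl ∘ 𝒟.embed) → t₁ = t₂ := by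
    intro O hO hγO huniq
    obtain ⟨ε, hε, hball⟩ := Metric.mem_nhds_iff.1 (hcont.preimage_mem_nhds (hO.mem_nhds hγO))
    have hpre : IsPreconnected (Metric.ball t ε ∩ s) := by
      rw [Real.ball_eq_Ioo]
      exact isPreconnected_iff_ordConnected.2 (ordConnected_Ioo.inter hγ.1)
    have hsubJ : Metric.ball t ε ∩ s ⊆ connectedComponentIn (s ∩ γ ⁻¹' O) t :=
      hpre.subset_connectedComponentIn ⟨Metric.mem_ball_self hε, ht⟩
        fun t' ht' ↦ ⟨ht'.2, hball ht'.1⟩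
    refine ⟨ε, hε, fun t₁ ht₁ t₂ ht₂ h₁ h₂ ↦ huniq t₁ (hsubJ ⟨?_, ht₁⟩) t₂ (hsubJ ⟨?_, ht₂⟩)⟩
    · rw [Metric.mem_ball, Real.dist_eq]; exact h₁
    · rw [Metric.mem_ball, Real.dist_eq]; exact h₂
  obtain (hl | hr) := (𝔠.glueData.range_inl_union_range_inr ▸ mem_univ (γ t) :
    γ t ∈ range 𝔠.inl ∪ range 𝔠.inr)
  · exact key _ 𝔠.glueData.isOpen_range_inl hl (crossing_inl h hγ ht hl).2
  · exact key _ 𝔠.glueData.isOpen_range_inr hr (crossing_inr h hγ ht hr).2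

/-- **Between a parameter mapped outside the overlap on one side and one mapped outside the
overlap on the other side there is a crossing** (the heart of Sbierski's uniqueness argument):
if `a, b ∈ s`, `γ a, γ b ∉ π j(U)`, and `γ([a, b])` meets both `π j(M)` and `π j'(M')`, then
`γ` crosses `ι̃(X)` strictly between `a` and `b` — `γ([a, b])` is connected, so it meets the
overlap `π j(M) ∩ π j'(M') = π j(U)` at some `t₂`; the piece through `t₂` inside the overlap stays
in `(a, b)` and meets `ι̃(X)` (`crossing_overlap`). [cite: Sbierski2016AHP, §3.3, proof of Thm. 5 (global hyperbolicity step)] -/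
theorem exists_crossing_between (h : ¬ 𝔠.HasCorrespondingBoundaryPoints) {γ : ℝ → 𝔠.Glued}
    {s : Set ℝ} (hγ : 𝔠.gluedMetric.IsEndlessTimelikeCurve (𝔠.gluedTimeOrientation h) γ s)
    {a b : ℝ} (ha : a ∈ s) (hb : b ∈ s)
    (haO : γ a ∉ range (𝔠.inl ∘ (Subtype.val : 𝔠.opens → 𝒟.carrier)))
    (hbO : γ b ∉ range (𝔠.inl ∘ (Subtype.val : 𝔠.opens → 𝒟.carrier)))
    (hinl : ∃ t ∈ Icc a b, γ t ∈ range 𝔠.inl) (hinr : ∃ t ∈ Icc a b, γ t ∈ range 𝔠.inr) :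
    ∃ t ∈ Ioo a b, γ t ∈ range (𝔠.inl ∘ 𝒟.embed) := by
  set O := range (𝔠.inl ∘ (Subtype.val : 𝔠.opens → 𝒟.carrier)) with hOdef
  have hOeq : O = range 𝔠.inl ∩ range 𝔠.inr := 𝔠.range_inl_comp_subtypeVal
  have hIcc : Icc a b ⊆ s := hγ.1.out ha hb
  have hcont : ContinuousOn γ (Icc a b) := fun t ht ↦
    (hγ.2.1 t (hIcc ht)).1.continuousAt.continuousWithinAt
  -- `γ([a, b])` meets the overlap
  obtain ⟨t₂, ht₂, hγt₂⟩ : ∃ t₂ ∈ Icc a b, γ t₂ ∈ O := by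
    have hpre : IsPreconnected (γ '' Icc a b) := isPreconnected_Icc.image γ hcont
    obtain ⟨ti, hti, hγti⟩ := hinl
    obtain ⟨tr, htr, hγtr⟩ := hinr
    obtain ⟨_, ⟨t₂, ht₂, rfl⟩, hmem⟩ := hpre _ _ 𝔠.glueData.isOpen_range_inl
      𝔠.glueData.isOpen_range_inr (by rw [𝔠.glueData.range_inl_union_range_inr]; exact subset_univ _)
      ⟨γ ti, ⟨ti, hti, rfl⟩, hγti⟩ ⟨γ tr, ⟨tr, htr, rfl⟩, hγtr⟩
    exact ⟨t₂, ht₂, by rw [hOeq]; exact hmem⟩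
  have ht₂s : t₂ ∈ s := hIcc ht₂
  -- the piece through `t₂` inside the overlap lies in `(a, b)`
  set J := connectedComponentIn (s ∩ γ ⁻¹' O) t₂ with hJ
  have hJsub : J ⊆ s ∩ γ ⁻¹' O := connectedComponentIn_subset _ _
  have ht₂J : t₂ ∈ J := mem_connectedComponentIn ⟨ht₂s, hγt₂⟩
  have hJord : J.OrdConnected :=
    isPreconnected_iff_ordConnected.1 isPreconnected_connectedComponentIn
  have haJ : a ∉ J := fun haJ ↦ haO (hJsub haJ).2
  have hbJ : b ∉ J := fun hbJ ↦ hbO (hJsub hbJ).2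
  have hJab : J ⊆ Ioo a b := fun t ht ↦ by
    constructor
    · by_contra hle
      exact haJ (hJord.out ht ht₂J ⟨not_lt.1 hle, ht₂.1⟩)
    · by_contra hle
      exact hbJ (hJord.out ht₂J ht ⟨ht₂.2, not_lt.1 hle⟩)
  obtain ⟨t, ht, hx⟩ := crossing_overlap h hγ ht₂s hγt₂
  exact ⟨t, hJab ht, hx⟩

/-- **No two consecutive crossings.** If `t₁ < t₃` are crossings of `ι̃(X)` with no crossing
strictly in between, contradiction: `[t₁, t₃]` does not stay in `π j(M)` (two crossings on one
piece of `π j(M)` coincide, `crossing_inl`) nor in `π j'(M')`, so there are `t', t'' ∈ (t₁, t₃)`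
with `γ t' ∉ π j(M)`, `γ t'' ∉ π j'(M')`, and `exists_crossing_between` yields a crossing strictly
between them. *"Thus, there must be `t₂, t₁₂, t₂₃` … But this leads to an inextendible timelike
curve in `U` that does not intersect `ι(M̄)`, a contradiction"* (Sbierski 2016, §3.3).
[cite: Sbierski2016AHP, §3.3, proof of Thm. 5 (global hyperbolicity step)] -/
theorem no_consecutive_crossings (h : ¬ 𝔠.HasCorrespondingBoundaryPoints) {γ : ℝ → 𝔠.Glued}
    {s : Set ℝ} (hγ : 𝔠.gluedMetric.IsEndlessTimelikeCurve (𝔠.gluedTimeOrientation h) γ s)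
    {t₁ t₃ : ℝ} (h13 : t₁ < t₃) (ht₁ : t₁ ∈ s) (ht₃ : t₃ ∈ s)
    (h₁ : γ t₁ ∈ range (𝔠.inl ∘ 𝒟.embed)) (h₃ : γ t₃ ∈ range (𝔠.inl ∘ 𝒟.embed))
    (hno : ∀ t ∈ Ioo t₁ t₃, γ t ∉ range (𝔠.inl ∘ 𝒟.embed)) : False := by
  have hIcc : Icc t₁ t₃ ⊆ s := hγ.1.out ht₁ ht₃
  have h₁' := 𝔠.range_gluedEmbed_subset h₁
  have h₃' := 𝔠.range_gluedEmbed_subset h₃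
  -- `[t₁, t₃]` leaves `π j(M)` …
  obtain ⟨t', ht', hγt'⟩ : ∃ t' ∈ Ioo t₁ t₃, γ t' ∉ range 𝔠.inl := by
    by_contra hall
    push Not at hall
    have hsub : Icc t₁ t₃ ⊆ connectedComponentIn (s ∩ γ ⁻¹' range 𝔠.inl) t₁ := by
      refine isPreconnected_Icc.subset_connectedComponentIn (left_mem_Icc.2 h13.le) fun t ht ↦ ⟨hIcc ht, ?_⟩
      rcases eq_or_lt_of_le ht.1 with rfl | hlt
      · exact h₁'.1
      rcases eq_or_lt_of_le ht.2 with rfl | hlt'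
      · exact h₃'.1
      · exact hall t ⟨hlt, hlt'⟩
    have := (crossing_inl h hγ ht₁ h₁'.1).2 t₁ (hsub (left_mem_Icc.2 h13.le)) t₃
      (hsub (right_mem_Icc.2 h13.le)) h₁ h₃
    exact absurd this h13.ne
  -- … and leaves `π j'(M')`
  obtain ⟨t'', ht'', hγt''⟩ : ∃ t'' ∈ Ioo t₁ t₃, γ t'' ∉ range 𝔠.inr := by
    by_contra hall
    push Not at hall
    have hsub : Icc t₁ t₃ ⊆ connectedComponentIn (s ∩ γ ⁻¹' range 𝔠.inr) t₁ := by
      refine isPreconnected_Icc.subset_connectedComponentIn (left_mem_Icc.2 h13.le) fun t ht ↦ ⟨hIcc ht, ?_⟩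
      rcases eq_or_lt_of_le ht.1 with rfl | hlt
      · exact h₁'.2
      rcases eq_or_lt_of_le ht.2 with rfl | hlt'
      · exact h₃'.2
      · exact hall t ⟨hlt, hlt'⟩
    have := (crossing_inr h hγ ht₁ h₁'.2).2 t₁ (hsub (left_mem_Icc.2 h13.le)) t₃
      (hsub (right_mem_Icc.2 h13.le)) h₁ h₃
    exact absurd this h13.ne
  -- the two escape parameters are different and outside the overlap
  have hcover : ∀ p : 𝔠.Glued, p ∈ range 𝔠.inl ∨ p ∈ range 𝔠.inr := fun p ↦
    (𝔠.glueData.range_inl_union_range_inr ▸ mem_univ p : p ∈ range 𝔠.inl ∪ range 𝔠.inr)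
  have hO : ∀ p : 𝔠.Glued, p ∈ range (𝔠.inl ∘ (Subtype.val : 𝔠.opens → 𝒟.carrier)) →
      p ∈ range 𝔠.inl ∧ p ∈ range 𝔠.inr := fun p hp ↦ by
    rw [𝔠.range_inl_comp_subtypeVal] at hp
    exact hp
  have ht's : t' ∈ s := hIcc ⟨ht'.1.le, ht'.2.le⟩
  have ht''s : t'' ∈ s := hIcc ⟨ht''.1.le, ht''.2.le⟩
  have hne : t' ≠ t'' := by
    rintro rfl
    rcases hcover (γ t') with hl | hr
    · exact hγt' hl
    · exact hγt'' hr
  have ht'O : γ t' ∉ range (𝔠.inl ∘ (Subtype.val : 𝔠.opens → 𝒟.carrier)) :=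
    fun hp ↦ hγt' (hO _ hp).1
  have ht''O : γ t'' ∉ range (𝔠.inl ∘ (Subtype.val : 𝔠.opens → 𝒟.carrier)) :=
    fun hp ↦ hγt'' (hO _ hp).2
  have hγt'r : γ t' ∈ range 𝔠.inr := (hcover (γ t')).resolve_left hγt'
  have hγt''l : γ t'' ∈ range 𝔠.inl := (hcover (γ t'')).resolve_right hγt''
  -- a crossing strictly between them
  rcases lt_or_gt_of_ne hne with hlt | hlt
  · obtain ⟨t, ht, hx⟩ := exists_crossing_between h hγ ht's ht''s ht'O ht''O
      ⟨t'', right_mem_Icc.2 hlt.le, hγt''l⟩ ⟨t', left_mem_Icc.2 hlt.le, hγt'r⟩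
    exact hno t ⟨ht'.1.trans ht.1, ht.2.trans ht''.2⟩ hx
  · obtain ⟨t, ht, hx⟩ := exists_crossing_between h hγ ht''s ht's ht''O ht'O
      ⟨t'', left_mem_Icc.2 hlt.le, hγt''l⟩ ⟨t', right_mem_Icc.2 hlt.le, hγt'r⟩
    exact hno t ⟨ht''.1.trans ht.1, ht.2.trans ht'.2⟩ hx

/-- **At most one crossing.** Two crossings `t₁ < t₃` of `ι̃(X)` by an endless timelike curve of
`M̃` lead to a contradiction: crossings are locally unique (`crossing_locally_unique`) and form
a closed set of parameters in `[t₁, t₃]` (`ι̃(X)` is closed), so there is a least crossing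
`t₃' > t₁`, consecutive to `t₁` — excluded by `no_consecutive_crossings`.
[cite: Sbierski2016AHP, §3.3, proof of Thm. 5 (global hyperbolicity step)] -/
theorem not_two_crossings (h : ¬ 𝔠.HasCorrespondingBoundaryPoints) {γ : ℝ → 𝔠.Glued}
    {s : Set ℝ} (hγ : 𝔠.gluedMetric.IsEndlessTimelikeCurve (𝔠.gluedTimeOrientation h) γ s)
    {t₁ t₃ : ℝ} (h13 : t₁ < t₃) (ht₁ : t₁ ∈ s) (ht₃ : t₃ ∈ s)
    (h₁ : γ t₁ ∈ range (𝔠.inl ∘ 𝒟.embed)) (h₃ : γ t₃ ∈ range (𝔠.inl ∘ 𝒟.embed)) : False := by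
  have hIcc : Icc t₁ t₃ ⊆ s := hγ.1.out ht₁ ht₃
  have hcont : ContinuousOn γ (Icc t₁ t₃) := fun t ht ↦
    (hγ.2.1 t (hIcc ht)).1.continuousAt.continuousWithinAt
  -- no crossing just after `t₁`
  obtain ⟨ε, hε, huniq⟩ := crossing_locally_unique h hγ ht₁
  have hε3 : t₁ + ε ≤ t₃ := by
    by_contra hlt
    have := huniq t₁ ht₁ t₃ ht₃ (by simp [hε]) (by rw [abs_lt]; constructor <;> linarith) h₁ h₃
    exact absurd this h13.ne
  -- the closed set of crossings in `[t₁ + ε, t₃]` and its least element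
  set C : Set ℝ := Icc (t₁ + ε) t₃ ∩ γ ⁻¹' range (𝔠.inl ∘ 𝒟.embed) with hC
  have hCcl : IsClosed C := (hcont.mono (Icc_subset_Icc_left (by linarith))).preimage_isClosed_of_isClosed
    isClosed_Icc 𝔠.isClosed_range_gluedEmbed
  have hCne : C.Nonempty := ⟨t₃, ⟨hε3, le_rfl⟩, h₃⟩
  have hCbdd : BddBelow C := ⟨t₁ + ε, fun t ht ↦ ht.1.1⟩
  set t₃' := sInf C with ht₃'
  have ht₃'C : t₃' ∈ C := hCcl.csInf_mem hCne hCbdd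
  have h13' : t₁ < t₃' := by linarith [ht₃'C.1.1]
  have ht₃'s : t₃' ∈ s := hIcc ⟨h13'.le, ht₃'C.1.2⟩
  -- no crossing strictly between `t₁` and `t₃'`
  refine no_consecutive_crossings h hγ h13' ht₁ ht₃'s h₁ ht₃'C.2 fun t ht hx ↦ ?_
  by_cases htε : t < t₁ + ε
  · have := huniq t₁ ht₁ t (hIcc ⟨ht.1.le, ht.2.le.trans ht₃'C.1.2⟩) (by simp [hε])
      (by rw [abs_lt]; constructor <;> linarith [ht.1]) h₁ hx
    exact absurd this ht.1.ne
  · have htC : t ∈ C := ⟨⟨not_lt.1 htε, ht.2.le.trans ht₃'C.1.2⟩, hx⟩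
    exact absurd (csInf_le hCbdd htC) (not_le.2 ht.2)

variable (𝔠)

/-- **`ι̃(X) = π j(ι(X))` is a Cauchy hypersurface of the glued spacetime `(M̃, g̃, T̃)`**
(Sbierski 2016, §3.3, proof of Thm. 5: *"`(M̃, g̃)` is globally hyperbolic with Cauchy surface
`ι̃(M̄)`"*): every endless timelike curve of `M̃` meets `ι̃(X)` — the piece through any of its
points inside `π j(M)` or `π j'(M')` lifts to an endless timelike curve of `M` or `M'`
(`crossing_inl`, `crossing_inr`) — and at most once (`not_two_crossings`).
[cite: Sbierski2016AHP, §3.3, proof of Thm. 5 ("`(M̃, g̃)` is globally hyperbolic with Cauchy surface `ι̃(M̄)`")] -/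
theorem isCauchyHypersurface_glued (h : ¬ 𝔠.HasCorrespondingBoundaryPoints) :
    𝔠.gluedMetric.IsCauchyHypersurface (𝔠.gluedTimeOrientation h) (range (𝔠.inl ∘ 𝒟.embed)) := by
  intro γ s hγ
  obtain ⟨t₀, ht₀⟩ := hγ.2.2.1.1
  -- existence of a crossing
  obtain ⟨tc, htc, hxc⟩ : ∃ tc ∈ s, γ tc ∈ range (𝔠.inl ∘ 𝒟.embed) := by
    rcases (𝔠.glueData.range_inl_union_range_inr ▸ mem_univ (γ t₀) :
      γ t₀ ∈ range 𝔠.inl ∪ range 𝔠.inr) with hl | hr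
    · obtain ⟨⟨t, ht, hx⟩, -⟩ := crossing_inl h hγ ht₀ hl
      exact ⟨t, (connectedComponentIn_subset _ _ ht).1, hx⟩
    · obtain ⟨⟨t, ht, hx⟩, -⟩ := crossing_inr h hγ ht₀ hr
      exact ⟨t, (connectedComponentIn_subset _ _ ht).1, hx⟩
  refine ⟨tc, ⟨htc, hxc⟩, fun t ⟨ht, hx⟩ ↦ ?_⟩
  -- uniqueness
  by_contra hne
  rcases lt_or_gt_of_ne hne with hlt | hlt
  · exact not_two_crossings h hγ hlt ht htc hx hxc
  · exact not_two_crossings h hγ hlt htc ht hxc hx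

end CommonDevelopment

end CauchyDevelopment

end Developments

end Literature.Geometry.Lorentzian

end
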